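import Summits.CriticalPhenomena.PercolationContinuityZ3.Theorems.PercNearOneGluingAdditiveGluingBlockGoodDetach
import HarnessLib

/-! # Crux `PercNearOneGluing.AdditiveGluing` (stmt-CriticalPhenomena-4576), kernel `residualKernel` — the DETACHED-DRIFT-FREE leaf
# (`blockGood_of_detachDriftFree`)

Invested seat `xfam-b` (cross-family direct attempt B on `residualKernel_two`); lands `--supports stmt-CriticalPhenomena-4576`; no
definitions, no named facts.

The fifth leaf of this seat's star programme (evidence note `XFAMB-residualKernelTwo-star.md`): detach the block `S` from the designated
relay `a₀` at two block vertices `x, y` (`blockGood_of_detach` twice — the slack only rescales), then close by the induction-hypothesis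
leaf `blockGood_leaf_ih` in the detached graph.  So **`blockGood_of_detachDriftFree`**: if, for the weighting `u⁰⁰` in which the pairs
`x–a₀`, `y–a₀` are killed, `a₀` minimises the GLUED two-point function `μ_{u⁰⁰/S}(· ↔ b)` over `A` and the glued quadruple
`(u⁰⁰/S, A, x, b)` is good (the induction hypothesis of `goodStep_of_residualKernelIH`), then `BG(u, A, S, b, a₀, sel)`.
For a 2-block `S = {x, y}` this is "no drift after detaching"; at `n = 6` it holds on every sampled instance of `residualKernel_two` that
escapes the four other leaves (`blockGood_leaf_delMin`, `blockGood_two_of_eraseMin` at `x` and at `y`, `blockGood_leaf_ih`), the only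
exceptions found being adversarially climbed near-ties (this seat's `lab/k6l`).
[cite: KozmaNitzan2024, §3.2 (pp. 12–14)]
-/

namespace Summit.CriticalPhenomena.PercolationContinuityZ3.Theorems

open MeasureTheory Set
open Literature.Probability.LatticeModels (prodBernoulli)
open Literature.Probability.Percolation (BondConfig openConn openConnIn openGraph openCluster pinW localCylinder)
open scoped BigOperators

noncomputable section
open Classical

section BlockGoodDetachDriftFree

open Literature.Probability.LatticeModels Literature.Probability.Percolation

variable {n : ℕ}

/-- **The detached-drift-free leaf.**  With `u⁰⁰ = pinW (pinW u {x–a₀} ∅) {y–a₀} ∅` (the block detached from `a₀` at `x` and `y`,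
`x, y ∈ S`, `a₀ ∈ A`, `a₀ ≠ x, y`): if `a₀` minimises `μ_{u⁰⁰/S}(· ↔ b)` over `A ∋ b` and `(u⁰⁰/S, A, x, b)` is good, then
`BG(u, A, S, b, a₀, sel)` for every selection `sel W ∈ A`. [cite: KozmaNitzan2024, §3.2 (pp. 12–14)] -/
theorem blockGood_of_detachDriftFree (u : Sym2 (Fin n) → unitInterval) (A S : Finset (Fin n)) (b a₀ x y : Fin n)
    (sel : Finset (Fin n) → Fin n) (hx : x ∈ S) (hy : y ∈ S) (hbA : b ∈ A) (ha₀A : a₀ ∈ A) (hax : a₀ ≠ x) (hay : a₀ ≠ y)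
    (hsel : ∀ W, sel W ∈ A)
    (hmin : ∀ a ∈ A, (prodBernoulli (fun e : Sym2 (Fin n) => if (∀ z ∈ e, z ∈ S) ∧ ¬ e.IsDiag then (1 : unitInterval) else (pinW (pinW u (↑({s(x, a₀)} : Finset (Sym2 (Fin n)))) ∅) (↑({s(y, a₀)} : Finset (Sym2 (Fin n)))) ∅) e)).real (openConn a₀ b) ≤ (prodBernoulli (fun e : Sym2 (Fin n) => if (∀ z ∈ e, z ∈ S) ∧ ¬ e.IsDiag then (1 : unitInterval) else (pinW (pinW u (↑({s(x, a₀)} : Finset (Sym2 (Fin n)))) ∅) (↑({s(y, a₀)} : Finset (Sym2 (Fin n)))) ∅) e)).real (openConn a b))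
    (hgood : ∀ (t : ℝ) (sel' : Finset (Fin n) → Fin n), (∀ W, sel' W ∈ A) →
      (∀ a ∈ A, 1 - t ≤ (prodBernoulli (fun e : Sym2 (Fin n) => if (∀ z ∈ e, z ∈ S) ∧ ¬ e.IsDiag then (1 : unitInterval) else (pinW (pinW u (↑({s(x, a₀)} : Finset (Sym2 (Fin n)))) ∅) (↑({s(y, a₀)} : Finset (Sym2 (Fin n)))) ∅) e)).real (openConn a b)) →
      (prodBernoulli (fun e : Sym2 (Fin n) => if (∀ z ∈ e, z ∈ S) ∧ ¬ e.IsDiag then (1 : unitInterval) else (pinW (pinW u (↑({s(x, a₀)} : Finset (Sym2 (Fin n)))) ∅) (↑({s(y, a₀)} : Finset (Sym2 (Fin n)))) ∅) e)).real ((⋃ a ∈ A, openConn x a) ∩ (openConn x b)ᶜ)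
        + ∑ W ∈ (Finset.univ : Finset (Finset (Fin n))).filter (fun W => x ∈ W ∧ Disjoint W A),
            (prodBernoulli (fun e : Sym2 (Fin n) => if (∀ z ∈ e, z ∈ S) ∧ ¬ e.IsDiag then (1 : unitInterval) else (pinW (pinW u (↑({s(x, a₀)} : Finset (Sym2 (Fin n)))) ∅) (↑({s(y, a₀)} : Finset (Sym2 (Fin n)))) ∅) e)).real {ω : BondConfig (Fin n) | openCluster ω x = (W : Set (Fin n))}
              * (prodBernoulli (fun e : Sym2 (Fin n) => if (∀ z ∈ e, z ∈ S) ∧ ¬ e.IsDiag then (1 : unitInterval) else (pinW (pinW u (↑({s(x, a₀)} : Finset (Sym2 (Fin n)))) ∅) (↑({s(y, a₀)} : Finset (Sym2 (Fin n)))) ∅) e)).real (openConnIn ((W : Set (Fin n))ᶜ) (sel' W) b)ᶜ ≤ t) :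
    (prodBernoulli u).real (openConn a₀ b)
        + (prodBernoulli u).real
            ((openConn a₀ b)ᶜ ∩ (⋃ s ∈ S, openConn a₀ s) ∩ (⋃ s ∈ S, openConn s b))
      ≤ (prodBernoulli u).real (⋃ s ∈ S, openConn s b)
        + ∑ W ∈ (Finset.univ : Finset (Finset (Fin n))).filter (fun W => Disjoint W A),
            (prodBernoulli u).real {ω : BondConfig (Fin n) | ∀ z : Fin n, (z ∈ W ↔ ω ∈ ⋃ s ∈ S, openConn s z)}
              * (prodBernoulli u).real (openConnIn ((W : Set (Fin n))ᶜ) (sel W) b) :=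
  blockGood_of_detach u A S b a₀ x sel hx ha₀A hax
    (blockGood_of_detach _ A S b a₀ y sel hy ha₀A hay
      (blockGood_leaf_ih _ A S b a₀ x sel hx hbA hsel hmin hgood))

end BlockGoodDetachDriftFree

open Literature.Probability.LatticeModels Literature.Probability.Percolation in
/-- Registered helper stub `stub_blockGoodOfDetachDriftFree_xb` (invested seat xfam-b): the detached-drift-free leaf — `BG` whenever `a₀` minimises
the glued two-point function of the weighting with the block detached from `a₀` at two block vertices and the glued detached quadruple is good
(= `blockGood_of_detachDriftFree`). [cite: KozmaNitzan2024, §3.2 (pp. 12–14)] -/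
theorem stub_blockGoodOfDetachDriftFree_xb : ∀ (n : ℕ) (u : Sym2 (Fin n) → unitInterval) (A S : Finset (Fin n)) (b a₀ x y : Fin n) (sel : Finset (Fin n) → Fin n), x ∈ S → y ∈ S → b ∈ A → a₀ ∈ A → a₀ ≠ x → a₀ ≠ y → (∀ W, sel W ∈ A) → (∀ a ∈ A, (prodBernoulli (fun e : Sym2 (Fin n) => if (∀ z ∈ e, z ∈ S) ∧ ¬ e.IsDiag then (1 : unitInterval) else (pinW (pinW u (↑({s(x, a₀)} : Finset (Sym2 (Fin n)))) ∅) (↑({s(y, a₀)} : Finset (Sym2 (Fin n)))) ∅) e)).real (openConn a₀ b) ≤ (prodBernoulli (fun e : Sym2 (Fin n) => if (∀ z ∈ e, z ∈ S) ∧ ¬ e.IsDiag then (1 : unitInterval) else (pinW (pinW u (↑({s(x, a₀)} : Finset (Sym2 (Fin n)))) ∅) (↑({s(y, a₀)} : Finset (Sym2 (Fin n)))) ∅) e)).real (openConn a b)) → (∀ (t : ℝ) (sel' : Finset (Fin n) → Fin n), (∀ W, sel' W ∈ A) → (∀ a ∈ A, 1 - t ≤ (prodBernoulli (fun e : Sym2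 (Fin n) => if (∀ z ∈ e, z ∈ S) ∧ ¬ e.IsDiag then (1 : unitInterval) else (pinW (pinW u (↑({s(x, a₀)} : Finset (Sym2 (Fin n)))) ∅) (↑({s(y, a₀)} : Finset (Sym2 (Fin n)))) ∅) e)).real (openConn a b)) → (prodBernoulli (fun e : Sym2 (Fin n) => if (∀ z ∈ e, z ∈ S) ∧ ¬ e.IsDiag then (1 : unitInterval) else (pinW (pinW u (↑({s(x, a₀)} : Finset (Sym2 (Fin n)))) ∅) (↑({s(y, a₀)} : Finset (Sym2 (Fin n)))) ∅) e)).real ((⋃ a ∈ A, openConn x a) ∩ (openConn x b)ᶜ) + ∑ W ∈ (Finset.univ : Finset (Finset (Fin n))).filter (fun W => x ∈ W ∧ Disjoint W A), (prodBernoulli (fun e : Sym2 (Fin n) => if (∀ z ∈ e, z ∈ S) ∧ ¬ e.IsDiag then (1 : unitInterval) else (pinW (pinW u (↑({s(x, a₀)} : Finset (Sym2 (Fin n)))) ∅) (↑({s(y, a₀)} : Finset (Sym2 (Fin n)))) ∅) e)).real {ω : BondConfig (Fin n) | openCluster ω x = (W : Set (Fin n))} * (prodBernoulli (fun e : Sym2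 (Fin n) => if (∀ z ∈ e, z ∈ S) ∧ ¬ e.IsDiag then (1 : unitInterval) else (pinW (pinW u (↑({s(x, a₀)} : Finset (Sym2 (Fin n)))) ∅) (↑({s(y, a₀)} : Finset (Sym2 (Fin n)))) ∅) e)).real (openConnIn ((W : Set (Fin n))ᶜ) (sel' W) b)ᶜ ≤ t) → (prodBernoulli u).real (openConn a₀ b) + (prodBernoulli u).real ((openConn a₀ b)ᶜ ∩ (⋃ s ∈ S, openConn a₀ s) ∩ (⋃ s ∈ S, openConn s b)) ≤ (prodBernoulli u).real (⋃ s ∈ S, openConn s b) + ∑ W ∈ (Finset.univ : Finset (Finset (Fin n))).filter (fun W => Disjoint W A), (prodBernoulli u).real {ω : BondConfig (Fin n) | ∀ z : Fin n, (z ∈ W ↔ ω ∈ ⋃ s ∈ S, openConn s z)} * (prodBernoulli u).real (openConnIn ((W : Set (Fin n))ᶜ) (sel W) b) :=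
  fun _ u A S b a₀ x y sel hx hy hbA ha₀A hax hay hsel hmin hgood =>
    blockGood_of_detachDriftFree u A S b a₀ x y sel hx hy hbA ha₀A hax hay hsel hmin hgood

end

end Summit.CriticalPhenomena.PercolationContinuityZ3.Theorems
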